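import Literature.Algebra.Polynomial.BasicSequenceClosedForms
import Mathlib.Tactic
import HarnessLib

/-!
# The Gould polynomials — the difference analogue of the Abel polynomials (Rota–Kahaner–Odlyzko §12)

G.-C. Rota, D. Kahaner, A. Odlyzko, *Finite operator calculus* (1973), §12 "Vandermonde
convolution", pp. 733–734:

> The difference analogs of Abel polynomials, with delta operator `E^{−b} Δ`, may be called the
> Gould polynomials and denoted by `G_n (x, b)`. By the corollary to Theorem 4, we readily find the
> explicit expressions for the `G_k (x, b)`: `A_k (x, b) = G_k (x, b)/k! = x/(x + bk) · C(x + bk, k)`.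
> We refer to Gould's papers for comparison. The identity expressing that these polynomials are of
> binomial type is sometimes known as the Vandermonde convolution …

Here `E^{−b} = τ_{−b}` (`Polynomial.taylor (−b)`), `Δ = τ_1 − I`, and — clearing the `k!` —
`G_n (x, b) = x (x + bn − 1)(x + bn − 2) ⋯ (x + bn − n + 1) = x · (x + bn − 1)_{n−1}` (`n ≥ 1`),
written with Mathlib's falling factorial `descPochhammer`. The basic-sequence property is Robert's
Translation Principle (`IsDeltaOperator.basicSequence_taylor_comp`) applied to `(x)_n`
(`basicSequence_taylor_sub_id`).

## References
* [RotaKahanerOdlyzko1973] G.-C. Rota, D. Kahaner, A. Odlyzko, *On the foundations of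
  combinatorial theory VIII. Finite operator calculus*, J. Math. Anal. Appl. 42 (1973) 684–760,
  §12, pp. 733–734.
* [Robert2000PadicAnalysis] A. M. Robert, *A Course in p-adic Analysis*, GTM 198, Springer (2000),
  Ch. IV §5.5 The Translation Principle, p. 204.
-/

noncomputable section

open Polynomial Finset

namespace Literature.Algebra.Polynomial

variable {K : Type*} [Field K]

/-- **The Gould polynomials** `G_0 (x, b) = 1`, `G_{n+1} (x, b) = x · (x + (n+1) b − 1)_n`, i.e.
`G_n (x, b) = x (x + bn − 1) ⋯ (x + bn − n + 1) = n! · x/(x + bn) · C(x + bn, n)`.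
[cite: RotaKahanerOdlyzko1973, §12, p. 733] -/
def gouldPolynomial (b : K) : ℕ → K[X]
  | 0 => 1
  | n + 1 => X * (descPochhammer K n).comp (X + C (((n + 1 : ℕ) : K) * b - 1))

/-- `G_0 = 1`. [cite: RotaKahanerOdlyzko1973, §12, p. 733] -/
theorem gouldPolynomial_zero (b : K) : gouldPolynomial b 0 = 1 :=
  rfl

/-- `G_{n+1} (x, b) = x · (x + (n+1) b − 1)_n`. [cite: RotaKahanerOdlyzko1973, §12, p. 733] -/
theorem gouldPolynomial_succ (b : K) (n : ℕ) :
    gouldPolynomial b (n + 1) = X * (descPochhammer K n).comp (X + C (((n + 1 : ℕ) : K) * b - 1)) :=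
  rfl

/-- `G_n (x, b) = x · (x + nb − 1)_{n−1}` for `n ≥ 1`. [cite: RotaKahanerOdlyzko1973, §12, p. 733] -/
theorem gouldPolynomial_of_ne_zero (b : K) {n : ℕ} (hn : n ≠ 0) :
    gouldPolynomial b n = X * (descPochhammer K (n - 1)).comp (X + C ((n : K) * b - 1)) := by
  obtain ⟨m, rfl⟩ := Nat.exists_eq_add_one_of_ne_zero hn
  rw [gouldPolynomial_succ, Nat.add_sub_cancel]

/-- `G_1 (x, b) = x`. [cite: RotaKahanerOdlyzko1973, §12, p. 733] -/
theorem gouldPolynomial_one (b : K) : gouldPolynomial b 1 = X := by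
  rw [gouldPolynomial_succ, descPochhammer_zero, one_comp, mul_one]

/-- `G_2 (x, b) = x (x + 2b − 1)`. [cite: RotaKahanerOdlyzko1973, §12, p. 733] -/
theorem gouldPolynomial_two (b : K) : gouldPolynomial b 2 = X * (X + C (2 * b - 1)) := by
  rw [gouldPolynomial_succ, descPochhammer_one, X_comp, show ((1 + 1 : ℕ) : K) = 2 by norm_num]

/-- `b = 0`: `G_n (x, 0) = (x)_n`, the basic polynomials of `Δ` itself.
[cite: RotaKahanerOdlyzko1973, §12, p. 733] [cite: Robert2000PadicAnalysis, Ch. IV §5.2, p. 196] -/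
theorem gouldPolynomial_zero_right_param (n : ℕ) : gouldPolynomial (0 : K) n = descPochhammer K n := by
  cases n with
  | zero => rw [gouldPolynomial_zero, descPochhammer_zero]
  | succ n => rw [gouldPolynomial_succ, mul_zero, zero_sub, C_neg, C_1, ← sub_eq_add_neg,
      descPochhammer_succ_left]

/-- **`E^{−b} Δ` is a delta operator.** [cite: RotaKahanerOdlyzko1973, §12, p. 733] -/
theorem isDeltaOperator_taylor_neg_comp_taylor_sub_id (b : K) :
    IsDeltaOperator (taylor (-b) ∘ₗ (taylor (1 : K) - LinearMap.id) : K[X] →ₗ[K] K[X]) :=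
  isDeltaOperator_taylor_sub_id.taylor_comp (-b)

variable [CharZero K]

/-- **The Gould polynomials are the basic polynomials of `E^{−b} Δ`** ("by the corollary to
Theorem 4", here Robert's Translation Principle applied to `(x)_n`).
[cite: RotaKahanerOdlyzko1973, §12, p. 733]
[cite: Robert2000PadicAnalysis, Ch. IV §5.5 The Translation Principle, p. 204] -/
theorem basicSequence_taylor_neg_comp_taylor_sub_id (b : K) (n : ℕ) :
    (isDeltaOperator_taylor_neg_comp_taylor_sub_id b).basicSequence n = gouldPolynomial b n := by
  rcases n with _ | m
  · exact (isDeltaOperator_taylor_neg_comp_taylor_sub_id b).isBasicSequence_basicSequence.apply_zero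
  · have h := (isDeltaOperator_taylor_sub_id (K := K)).basicSequence_taylor_comp (-b)
      (Nat.add_one_ne_zero m)
    rw [basicSequence_taylor_sub_id, descPochhammer_succ_left,
      Literature.RingTheory.MvPolynomial.KaltofenBounds.divX_X_mul, mul_neg, neg_neg, taylor_apply,
      comp_assoc, sub_comp, X_comp, one_comp] at h
    rw [gouldPolynomial_succ, map_sub, C_1, ← add_sub_assoc]
    exact h

/-- **`(G_n (·, b))_n` is the basic sequence of `E^{−b} Δ`.** [cite: RotaKahanerOdlyzko1973, §12,
p. 733] -/
theorem isBasicSequence_gouldPolynomial (b : K) :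
    IsBasicSequence (taylor (-b) ∘ₗ (taylor (1 : K) - LinearMap.id) : K[X] →ₗ[K] K[X])
      (gouldPolynomial b) := by
  rw [show gouldPolynomial b = (isDeltaOperator_taylor_neg_comp_taylor_sub_id b).basicSequence from
    (funext (basicSequence_taylor_neg_comp_taylor_sub_id b)).symm]
  exact (isDeltaOperator_taylor_neg_comp_taylor_sub_id b).isBasicSequence_basicSequence

/-- **The explicit expression as printed**, `G_n (x, b)/n! = x/(x + bn) · C(x + bn, n)`, cleared of
denominators: `(x + bn) · G_n (x, b) = x · (x + bn)_n`.
[cite: RotaKahanerOdlyzko1973, §12, p. 733]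
[cite: Robert2000PadicAnalysis, Ch. IV §5.5 The Translation Principle, p. 204] -/
theorem X_add_C_mul_gouldPolynomial (b : K) (n : ℕ) :
    (X + C ((n : K) * b)) * gouldPolynomial b n = X * (descPochhammer K n).comp (X + C ((n : K) * b)) := by
  rcases Nat.eq_zero_or_pos n with rfl | hn
  · rw [gouldPolynomial_zero, descPochhammer_zero, one_comp, Nat.cast_zero, zero_mul, C_0, add_zero]
  · have h := (isDeltaOperator_taylor_sub_id (K := K)).X_sub_C_mul_basicSequence_taylor_comp (-b) hn.ne'
    rw [basicSequence_taylor_neg_comp_taylor_sub_id, basicSequence_taylor_sub_id, mul_neg, C_neg,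
      sub_neg_eq_add] at h
    exact h

/-- **The Vandermonde convolution** — the Gould polynomials are of binomial type:
`G_n (x + y, b) = Σ_k C(n,k) G_k (x, b) G_{n−k} (y, b)`.
[cite: RotaKahanerOdlyzko1973, §12 ("the identity expressing that these polynomials are of binomial
type is sometimes known as the Vandermonde convolution"), p. 734]
[cite: RotaKahanerOdlyzko1973, §2 Theorem 1 (a), p. 689] -/
theorem gouldPolynomial_eval_add (b : K) (n : ℕ) (x y : K) :
    (gouldPolynomial b n).eval (x + y) =
      ∑ k ∈ range (n + 1), (n.choose k : K) * (gouldPolynomial b k).eval x *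
        (gouldPolynomial b (n - k)).eval y :=
  (isBasicSequence_gouldPolynomial b).eval_add_self (isDeltaOperator_taylor_neg_comp_taylor_sub_id b) n x y

/-- `E^{−b} Δ G_{n+1} = (n+1) G_n`. [cite: RotaKahanerOdlyzko1973, §12, p. 733] -/
theorem taylor_neg_sub_gouldPolynomial_succ (b : K) (n : ℕ) :
    taylor (-b) (taylor 1 (gouldPolynomial b (n + 1)) - gouldPolynomial b (n + 1)) =
      ((n + 1 : ℕ) : K) • gouldPolynomial b n := by
  have h := (isBasicSequence_gouldPolynomial b).map_succ n
  rwa [LinearMap.comp_apply, LinearMap.sub_apply, LinearMap.id_apply] at h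

/-- `b = 1`: `E^{−1} Δ = ∇_-` is the backward difference and `G_n (x, 1) = x (x+1) ⋯ (x+n−1)`
(Mathlib `ascPochhammer`; Robert §5.5 "the case `a = −1` leads to `τ_{−1} ∇ = ∇_-`").
[cite: RotaKahanerOdlyzko1973, §12, p. 733] [cite: Robert2000PadicAnalysis, Ch. IV §5.5, p. 204] -/
theorem gouldPolynomial_one_right_param (n : ℕ) : gouldPolynomial (1 : K) n = ascPochhammer K n := by
  have hb : IsBasicSequence (taylor (-1) ∘ₗ (taylor (1 : K) - LinearMap.id)) (ascPochhammer K) := by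
    rw [← id_sub_taylor_eq]
    exact isBasicSequence_ascPochhammer
  exact congrFun ((isBasicSequence_gouldPolynomial 1).unique
    (isDeltaOperator_taylor_neg_comp_taylor_sub_id 1) hb) n

end Literature.Algebra.Polynomial
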